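import Summits.QuantumFields.YangMills.Theorems.CurvatureKernelBound.Negative.OrderCore

/-!
# `CurvatureKernelBound` — negative lemmas VI: the massless moment of `L₈` (numbers, IBP, cut-off weight)

Supports crux item `stmt-QuantumFields-11687` (`PencilRigidity.CurvatureKernelBound`: for every compact simple
`G`, `r`, `sch` and one-species `S₁` carrying the curvature package `W₁`, the two-point function of `S₁` on `⁰𝒮`
is integration against a REAL kernel `K(x₀ − x₁)`, continuous off `0`, with `|K x| ≤ C (1 + ‖x‖^(η−10))`,
`η > 0`). Standing disprover's negative lemmas (refuter, cdisprove); no conclusion below asserts a Theses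
statement positively.

§G'' the exact eighth derivatives `d⁸/dt⁸ (1+t²)⁻¹|₀ = 8!`, `d⁸/dt⁸ (1+t)⁻²|₀ = 9!` and `3·8! + 9! = 483840`;
§H Schwartz integration by parts ×n against a constant-coefficient line derivative
(`integral_mul_iteratedLineDerivOp_const`), restriction of iterated derivatives to lines (`iteratedDeriv_line`),
the base point `(e₁, 0)` and the directions `V0 μ = (e_μ, 0)`; §H' the cut-off massless weight
`ΛS = χ₀ · (4π²‖u₀−u₁‖²)⁻¹` as a Schwartz function and the values `∂_{(0,μ)}⁸ ΛS (e₁,0)`, summing to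
`H8_basePt : (Σ_μ ∂_{(0,μ)}⁸ ΛS)(e₁,0) = 483840/(4π²)` with positive real part. [folklore]
-/

open scoped BigOperators Topology SchwartzMap
open MeasureTheory Filter Set
open Literature.MathematicalPhysics.QuantumLattice Literature.MathematicalPhysics.AQFT
  Literature.MathematicalPhysics.QuantumFieldTheory

noncomputable section

namespace Summit.QuantumFields.YangMills.Theorems.CurvatureKernelBound.Negative

/-! ## §G'' The numbers: `d⁸/dt⁸ (1+t²)⁻¹ |₀ = 8! = 40320`, `d⁸/dt⁸ (1+t)⁻² |₀ = 9! = 362880`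
(so `Σ_μ ∂_μ⁸ ‖w‖⁻² (e₁) = 3·40320 + 362880 = 483840 > 0`). -/

section Numbers

/-- `d⁸/dt⁸ (1+t)⁻²` at `t = 0` is `9! = 362880`. -/
theorem iteratedDeriv_eight_inv_sq_one_add :
    iteratedDeriv 8 (fun t : ℝ => ((1 + t) ^ 2)⁻¹) 0 = 362880 := by
  have h : (fun t : ℝ => ((1 + t) ^ 2)⁻¹) = fun t => (fun x : ℝ => x ^ (-2 : ℤ)) (1 + t) := by
    funext t
    simp only [zpow_neg, zpow_ofNat]
  rw [h, iteratedDeriv_comp_const_add 8 (fun x : ℝ => x ^ (-2 : ℤ)) 1]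
  simp only [add_zero]
  rw [iteratedDeriv_eq_iterate, iter_deriv_zpow]
  norm_num [Finset.prod_range_succ]

/-- `d⁸/dt⁸ (1+t²)⁻¹` at `t = 0` is `8! = 40320` (partial fractions: `(1+t²)⁻¹ = Re (1 - it)⁻¹`). -/
theorem iteratedDeriv_eight_inv_one_add_sq :
    iteratedDeriv 8 (fun t : ℝ => (1 + t ^ 2)⁻¹) 0 = 40320 := by
  set e : ℂ → ℂ := fun z => (-Complex.I * z + 1)⁻¹ with he
  have hre : (fun t : ℝ => (1 + t ^ 2)⁻¹) = fun t : ℝ => (e t).re := by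
    funext t
    simp only [e, Complex.inv_re, Complex.normSq_apply]
    simp
    ring
  have hder : ∀ k : ℕ, deriv^[k] e = fun z => (-1) ^ k * (k.factorial : ℂ) * (-Complex.I) ^ k *
      (-Complex.I * z + 1) ^ (-1 - k : ℤ) :=
    fun k => iter_deriv_inv_linear k (-Complex.I) 1
  have hb : ∀ t : ℝ, (-Complex.I * (t : ℂ) + 1) ≠ 0 := by
    intro t h0
    have := congrArg Complex.re h0
    simp at this
  have hreal : ∀ k : ℕ, iteratedDeriv k (fun t : ℝ => (e t).re) =
      fun t : ℝ => ((deriv^[k] e) (t : ℂ)).re := by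
    intro k
    induction k with
    | zero => funext t; simp
    | succ k ih =>
      rw [iteratedDeriv_succ, ih]
      funext t
      have hd : HasDerivAt (deriv^[k] e) ((deriv^[k + 1] e) t) t := by
        rw [Function.iterate_succ_apply']
        refine DifferentiableAt.hasDerivAt ?_
        rw [hder k]
        have hf : DifferentiableAt ℂ (fun z : ℂ => -Complex.I * z + 1) (t : ℂ) := by fun_prop
        exact (hf.zpow (Or.inl (hb t))).const_mul _
      exact hd.real_of_complex.deriv
  rw [hre, hreal 8]
  simp only [hder 8]
  have hI : (-Complex.I) ^ 8 = 1 := by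
    have : (-Complex.I) ^ 8 = (Complex.I ^ 2) ^ 4 := by ring
    rw [this, Complex.I_sq]; norm_num
  simp [hI, Nat.factorial]
  norm_num

/-- The blueprint number: `3 · 8! + 9! = 483840`. -/
theorem blueprint_number : (3 * 40320 + 362880 : ℝ) = 483840 := by norm_num

end Numbers

/-! ## §H The massless moment of `L₈` is nonzero (residue R2): tools -/

section MomentTools

open Real
open scoped LineDeriv

/-- Iterated Schwartz integration by parts along a fixed direction. -/
theorem integral_mul_iteratedLineDerivOp_const (n : ℕ) (v : Fin 2 → E4)
    (f g : 𝓢((Fin 2 → E4), ℂ)) :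
    ∫ x, f x * (∂^{fun _ : Fin n => v} g) x = (-1) ^ n * ∫ x, (∂^{fun _ : Fin n => v} f) x * g x := by
  induction n generalizing f g with
  | zero => simp
  | succ n ih =>
    rw [LineDeriv.iteratedLineDerivOp_succ_left]
    have htail : (Fin.tail fun _ : Fin (n + 1) => v) = fun _ : Fin n => v := rfl
    rw [htail]
    show ∫ x, f x * (∂_{v} (∂^{fun _ : Fin n => v} g)) x = _
    rw [SchwartzMap.integral_mul_lineDerivOp_right_eq_neg_left, ih (∂_{v} f) g]
    have hsucc : ∂^{fun _ : Fin (n + 1) => v} f = ∂^{fun _ : Fin n => v} (∂_{v} f) := by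
      rw [LineDeriv.iteratedLineDerivOp_succ_right]; rfl
    rw [hsucc, pow_succ]
    ring

/-- Iterated line derivatives along one direction are iterated derivatives of the line restriction. -/
theorem iteratedDeriv_line (n : ℕ) (f : 𝓢((Fin 2 → E4), ℂ)) (x v : Fin 2 → E4) :
    iteratedDeriv n (fun t : ℝ => f (x + t • v)) 0 = (∂^{fun _ : Fin n => v} f) x := by
  rw [SchwartzMap.iteratedLineDerivOp_eq_iteratedFDeriv, iteratedDeriv_eq_iteratedFDeriv]
  let g : ℝ →L[ℝ] (Fin 2 → E4) := ContinuousLinearMap.toSpanSingleton ℝ v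
  have hfun : (fun t : ℝ => f (x + t • v)) = (fun y : Fin 2 → E4 => f (y + x)) ∘ g := by
    funext t
    simp [g, ContinuousLinearMap.toSpanSingleton_apply, add_comm]
  have hF : ContDiff ℝ n (fun y : Fin 2 → E4 => f (y + x)) :=
    (f.smooth n).comp (contDiff_id.add contDiff_const)
  rw [hfun, ContinuousLinearMap.iteratedFDeriv_comp_right g hF 0 le_rfl]
  simp only [ContinuousMultilinearMap.compContinuousLinearMap_apply]
  have h0 : g 0 = 0 := by simp [g]
  rw [h0, iteratedFDeriv_comp_add_right' n x]
  simp [g, ContinuousLinearMap.toSpanSingleton_apply]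

/-- `iteratedDeriv` commutes with the real-to-complex coercion (local smoothness suffices). -/
theorem iteratedDeriv_ofReal_comp {q : ℝ → ℝ} {x : ℝ} {n : ℕ} (hq : ContDiffAt ℝ n q x) :
    iteratedDeriv n (fun t => (q t : ℂ)) x = ((iteratedDeriv n q x : ℝ) : ℂ) := by
  rw [iteratedDeriv_eq_iteratedFDeriv, iteratedDeriv_eq_iteratedFDeriv]
  have h := ContinuousLinearMap.iteratedFDeriv_comp_left Complex.ofRealCLM hq (i := n) le_rfl
  have hfun : (fun t => (q t : ℂ)) = Complex.ofRealCLM ∘ q := rfl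
  rw [hfun, h]
  rfl

/-- The base point `c = (e₁, 0)` of the moment computation. -/
def basePt : Fin 2 → E4 := ![EuclideanSpace.single 1 1, 0]

/-- First component of the base point. [folklore] -/
@[simp] theorem basePt_zero : basePt 0 = EuclideanSpace.single 1 1 := rfl
/-- Second component of the base point. [folklore] -/
@[simp] theorem basePt_one : basePt 1 = 0 := rfl
/-- First component of the direction `V0 μ`. [folklore] -/
@[simp] theorem V0_apply_zero (μ : Fin 4) : V0 μ 0 = EuclideanSpace.single μ 1 := by simp [V0]
/-- Second component of the direction `V0 μ`. [folklore] -/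
@[simp] theorem V0_apply_one (μ : Fin 4) : V0 μ 1 = 0 := by simp [V0]

/-- The directions `V0 μ` are unit vectors. [folklore] -/
theorem norm_V0 (μ : Fin 4) : ‖V0 μ‖ = 1 := by
  rw [V0, Pi.norm_single, PiLp.norm_single, norm_one]

/-- `‖e₁ + t e_μ‖² = 1 + t²` for `μ ≠ 1`. -/
theorem norm_sq_line_of_ne {μ : Fin 4} (hμ : μ ≠ 1) (t : ℝ) :
    ‖(EuclideanSpace.single 1 1 + t • EuclideanSpace.single μ 1 : E4)‖ ^ 2 = 1 + t ^ 2 := by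
  rw [EuclideanSpace.real_norm_sq_eq]
  fin_cases μ
  · simp [Fin.sum_univ_four]; try ring
  · exact absurd rfl hμ
  · simp [Fin.sum_univ_four]; try ring
  · simp [Fin.sum_univ_four]; try ring

/-- `‖e₁ + t e₁‖² = (1 + t)²`. -/
theorem norm_sq_line_one (t : ℝ) :
    ‖(EuclideanSpace.single 1 1 + t • EuclideanSpace.single 1 1 : E4)‖ ^ 2 = (1 + t) ^ 2 := by
  rw [EuclideanSpace.real_norm_sq_eq]
  simp [Fin.sum_univ_four]; try ring

/-- The massless weight along the four coordinate lines through `c`. -/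
theorem masslessWeight_line_of_ne {μ : Fin 4} (hμ : μ ≠ 1) (t : ℝ) :
    masslessWeight (basePt + t • V0 μ) = (4 * π ^ 2)⁻¹ * (1 + t ^ 2)⁻¹ := by
  unfold masslessWeight
  have : (basePt + t • V0 μ) 0 - (basePt + t • V0 μ) 1 =
      EuclideanSpace.single 1 1 + t • EuclideanSpace.single μ 1 := by
    simp [Pi.add_apply, Pi.smul_apply]
  rw [this, norm_sq_line_of_ne hμ]
  field_simp

/-- The massless weight along the line through the base point in direction `V0 1`. [folklore] -/
theorem masslessWeight_line_one (t : ℝ) :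
    masslessWeight (basePt + t • V0 1) = (4 * π ^ 2)⁻¹ * ((1 + t) ^ 2)⁻¹ := by
  unfold masslessWeight
  have : (basePt + t • V0 1) 0 - (basePt + t • V0 1) 1 =
      EuclideanSpace.single 1 1 + t • EuclideanSpace.single 1 1 := by
    simp [Pi.add_apply, Pi.smul_apply]
  rw [this, norm_sq_line_one]
  rw [one_div, mul_inv]

end MomentTools

/-! ## §H' The cut-off massless weight `ΛS` and the values `∂_{(0,μ)}⁸ ΛS (c)` -/

section MomentCutoff

open Real
open scoped LineDeriv ContDiff

/-- The fixed cutoff around `c = (e₁, 0)` (sup-norm radii `1/4 < 1/3`). -/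
def chi0 : ContDiffBump basePt := ⟨1 / 4, 1 / 3, by norm_num, by norm_num⟩

/-- The cut-off massless weight `Λ = χ₀ · (4π²‖u₀-u₁‖²)⁻¹`. -/
def Lam (u : Fin 2 → E4) : ℝ := chi0 u * masslessWeight u

/-- The off-diagonal set `{u₀ ≠ u₁}` is open. [folklore] -/
theorem isOpen_offDiag : IsOpen {u : Fin 2 → E4 | u 0 - u 1 ≠ 0} :=
  isOpen_ne_fun ((continuous_apply 0).sub (continuous_apply 1)) continuous_const

/-- The massless weight is smooth off the diagonal. [folklore] -/
theorem masslessWeight_contDiffOn :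
    ContDiffOn ℝ ∞ masslessWeight {u : Fin 2 → E4 | u 0 - u 1 ≠ 0} := by
  have hlin : ContDiff ℝ ∞ (fun u : Fin 2 → E4 => u 0 - u 1) :=
    ((ContinuousLinearMap.proj (R := ℝ) (φ := fun _ : Fin 2 => E4) 0) -
      (ContinuousLinearMap.proj (R := ℝ) (φ := fun _ : Fin 2 => E4) 1)).contDiff
  have h1 : ContDiff ℝ ∞ (fun u : Fin 2 → E4 => ‖u 0 - u 1‖ ^ 2) := (contDiff_norm_sq ℝ).comp hlin
  unfold masslessWeight
  refine ContDiffOn.div contDiffOn_const (contDiffOn_const.mul h1.contDiffOn) ?_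
  intro u hu
  have : ‖u 0 - u 1‖ ≠ 0 := norm_ne_zero_iff.2 hu
  positivity

/-- `‖e₁‖ = 1`. [folklore] -/
theorem norm_single_one_one : ‖(EuclideanSpace.single (1 : Fin 4) (1 : ℝ) : E4)‖ = 1 := by
  rw [PiLp.norm_single, norm_one]

/-- Points within sup-distance `< 1/2` of `c` are off the diagonal, with `1/2 < ‖u₀-u₁‖ < 3/2`. -/
theorem offDiag_of_near_basePt {u : Fin 2 → E4} {ρ : ℝ} (hρ : ρ < 1 / 2) (hu : ‖u - basePt‖ ≤ ρ) :
    u 0 - u 1 ≠ 0 ∧ 1 - 2 * ρ ≤ ‖u 0 - u 1‖ ∧ ‖u 0 - u 1‖ ≤ 1 + 2 * ρ := by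
  have h0 : ‖u 0 - EuclideanSpace.single 1 1‖ ≤ ρ := by
    have := norm_le_pi_norm (u - basePt) 0; simp at this; linarith
  have h1 : ‖u 1‖ ≤ ρ := by
    have := norm_le_pi_norm (u - basePt) 1; simp at this; linarith
  have hdecomp : u 0 - u 1 = EuclideanSpace.single 1 1 + ((u 0 - EuclideanSpace.single 1 1) - u 1) := by
    abel
  have hsmall : ‖(u 0 - EuclideanSpace.single 1 1) - u 1‖ ≤ 2 * ρ :=
    (norm_sub_le _ _).trans (by linarith)
  have hlow : 1 - 2 * ρ ≤ ‖u 0 - u 1‖ := by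
    rw [hdecomp]
    have := norm_sub_norm_le (EuclideanSpace.single (1 : Fin 4) (1 : ℝ) : E4)
      (-((u 0 - EuclideanSpace.single 1 1) - u 1))
    rw [sub_neg_eq_add, norm_neg, norm_single_one_one] at this
    linarith
  have hup : ‖u 0 - u 1‖ ≤ 1 + 2 * ρ := by
    rw [hdecomp]
    refine (norm_add_le _ _).trans ?_
    rw [norm_single_one_one]; linarith
  refine ⟨fun h => ?_, hlow, hup⟩
  rw [h, norm_zero] at hlow
  linarith

/-- The cut-off `χ₀` is supported off the diagonal. [folklore] -/
theorem tsupport_chi0_subset : tsupport chi0 ⊆ {u : Fin 2 → E4 | u 0 - u 1 ≠ 0} := by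
  intro u hu
  rw [chi0.tsupport_eq, Metric.mem_closedBall, dist_eq_norm] at hu
  exact (offDiag_of_near_basePt (ρ := 1 / 3) (by norm_num) hu).1

/-- The cut-off massless weight `Λ` is smooth. [folklore] -/
theorem contDiff_Lam : ContDiff ℝ ∞ Lam := by
  rw [contDiff_iff_contDiffAt]
  intro u
  by_cases hu : u ∈ tsupport chi0
  · have hU : {u : Fin 2 → E4 | u 0 - u 1 ≠ 0} ∈ 𝓝 u :=
      isOpen_offDiag.mem_nhds (tsupport_chi0_subset hu)
    exact chi0.contDiff.contDiffAt.mul (masslessWeight_contDiffOn.contDiffAt hU)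
  · have h0 : Lam =ᶠ[𝓝 u] fun _ => 0 := by
      filter_upwards [notMem_tsupport_iff_eventuallyEq.1 hu] with y hy
      simp [Lam, hy]
    exact (contDiffAt_const (c := (0 : ℝ))).congr_of_eventuallyEq h0

/-- The cut-off massless weight `Λ` has compact support. [folklore] -/
theorem hasCompactSupport_Lam : HasCompactSupport Lam :=
  chi0.hasCompactSupport.mul_right

/-- `ΛS`: the cut-off massless weight as a (complex-valued) Schwartz function. -/
def LamS : 𝓢((Fin 2 → E4), ℂ) :=
  (hasCompactSupport_Lam.comp_left Complex.ofReal_zero).toSchwartzMap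
    (Complex.ofRealCLM.contDiff.comp contDiff_Lam)

/-- Pointwise formula for `ΛS`. [folklore] -/
@[simp] theorem LamS_apply (u : Fin 2 → E4) : LamS u = ((Lam u : ℝ) : ℂ) := rfl

/-- `ΛS = (4π²‖u₀-u₁‖²)⁻¹` within sup-distance `1/4` of `c`. -/
theorem LamS_eq_of_near {u : Fin 2 → E4} (hu : ‖u - basePt‖ ≤ 1 / 4) :
    LamS u = ((masslessWeight u : ℝ) : ℂ) := by
  rw [LamS_apply, Lam, chi0.one_of_mem_closedBall, one_mul]
  rwa [Metric.mem_closedBall, dist_eq_norm]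

/-- The cut-off equals `1` on the short line segments through the base point. [folklore] -/
theorem chi0_line_eq_one {μ : Fin 4} {t : ℝ} (ht : |t| ≤ 1 / 4) : chi0 (basePt + t • V0 μ) = 1 := by
  refine chi0.one_of_mem_closedBall ?_
  rw [Metric.mem_closedBall, dist_eq_norm, add_sub_cancel_left, norm_smul, norm_V0, mul_one,
    Real.norm_eq_abs]
  exact ht

/-- `∂_{(0,μ)}⁸ ΛS (c) = 8!/(4π²)` for `μ ≠ 1`. -/
theorem D8_LamS_basePt_of_ne {μ : Fin 4} (hμ : μ ≠ 1) :
    D8 μ LamS basePt = (((4 * π ^ 2)⁻¹ * 40320 : ℝ) : ℂ) := by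
  rw [D8_apply, ← iteratedDeriv_line 8 LamS basePt (V0 μ)]
  have hgerm : (fun t : ℝ => LamS (basePt + t • V0 μ)) =ᶠ[𝓝 0]
      fun t => (((4 * π ^ 2)⁻¹ * (1 + t ^ 2)⁻¹ : ℝ) : ℂ) := by
    filter_upwards [Metric.closedBall_mem_nhds (0 : ℝ) (by norm_num : (0 : ℝ) < 1 / 4)] with t ht
    rw [Metric.mem_closedBall, dist_zero_right, Real.norm_eq_abs] at ht
    rw [LamS_apply, Lam, chi0_line_eq_one ht, one_mul, masslessWeight_line_of_ne hμ]
  have hq : ContDiffAt ℝ 8 (fun t : ℝ => (1 + t ^ 2)⁻¹) 0 :=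
    (contDiffAt_const.add (contDiffAt_id.pow 2)).inv (by norm_num)
  rw [hgerm.iteratedDeriv_eq, iteratedDeriv_ofReal_comp (contDiffAt_const.mul hq),
    iteratedDeriv_const_mul _ hq, iteratedDeriv_eight_inv_one_add_sq]

/-- `∂_{(0,1)}⁸ ΛS (c) = 9!/(4π²)`. -/
theorem D8_LamS_basePt_one :
    D8 1 LamS basePt = (((4 * π ^ 2)⁻¹ * 362880 : ℝ) : ℂ) := by
  rw [D8_apply, ← iteratedDeriv_line 8 LamS basePt (V0 1)]
  have hgerm : (fun t : ℝ => LamS (basePt + t • V0 1)) =ᶠ[𝓝 0]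
      fun t => (((4 * π ^ 2)⁻¹ * ((1 + t) ^ 2)⁻¹ : ℝ) : ℂ) := by
    filter_upwards [Metric.closedBall_mem_nhds (0 : ℝ) (by norm_num : (0 : ℝ) < 1 / 4)] with t ht
    rw [Metric.mem_closedBall, dist_zero_right, Real.norm_eq_abs] at ht
    rw [LamS_apply, Lam, chi0_line_eq_one ht, one_mul, masslessWeight_line_one]
  have hq : ContDiffAt ℝ 8 (fun t : ℝ => ((1 + t) ^ 2)⁻¹) 0 :=
    ((contDiffAt_const.add contDiffAt_id).pow 2).inv (by norm_num)
  rw [hgerm.iteratedDeriv_eq, iteratedDeriv_ofReal_comp (contDiffAt_const.mul hq),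
    iteratedDeriv_const_mul _ hq, iteratedDeriv_eight_inv_sq_one_add]

/-- The kernel-side Schwartz function `H = Σ_μ ∂_{(0,μ)}⁸ ΛS` … -/
def H8 : 𝓢((Fin 2 → E4), ℂ) := ∑ μ : Fin 4, D8 μ LamS

/-- … and its value at `c`: `483840/(4π²) > 0`. -/
theorem H8_basePt : H8 basePt = (((4 * π ^ 2)⁻¹ * 483840 : ℝ) : ℂ) := by
  rw [H8, sum_apply, Fin.sum_univ_four, D8_LamS_basePt_of_ne (by decide),
    D8_LamS_basePt_one, D8_LamS_basePt_of_ne (by decide), D8_LamS_basePt_of_ne (by decide)]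
  push_cast
  ring

/-- The value `H8 (e₁,0)` has positive real part. [folklore] -/
theorem H8_basePt_re_pos : 0 < (H8 basePt).re := by
  rw [H8_basePt, Complex.ofReal_re]
  positivity

end MomentCutoff

end Summit.QuantumFields.YangMills.Theorems.CurvatureKernelBound.Negative
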